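import Mathlib
import HarnessLib
import Summits.HubbardSuperconductivity.HubbardSuperconductivity.Theorems.KLProgrammeKLRegimeSplitGlueP4
import Summits.HubbardSuperconductivity.HubbardSuperconductivity.Theorems.KLProgrammeKLRegimeSplitBundleV12

/-!
# Route `KLProgramme` — the K3-NAMED glue of the five gen-4 children at the bundle `klPredsV12` (Δ16–Δ20 + Δ21), v4 staging
# (`EngineP4` / `VolumeLimitP2`, p1's `…SplitGlueP4`) (stmt-HubbardSuperconductivity-19937; DOWNSTREAM of the route file — this is the one
# leaf of the gen-4 family that imports it; cell gate-hubbard-kl, seat p1 g7)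

`KLRegimeInductionV12P4 := KLRegimeInductionP4 klPredsV12 FinalTwoLegVolLimit`.  Nothing else is asserted.
-/

noncomputable section

namespace Summit.HubbardSuperconductivity.HubbardSuperconductivity.Theorems.KLRegimeSplit

set_option linter.dupNamespace false -- summit = problem name (single-conjunct summit), D-0017

/-- **The K3-named glue at `klPredsV12`, v4 staging**: `EngineP4 klPredsV12 klWindowC`, `BetaSplitP klPredsV12 klWindowC`,
`CountertermP2 klPredsV12 klWindowC`, `VolumeLimitP2 klPredsV12 FinalTwoLegVolLimit klWindowC`, `TwoPointAssemblyP3 klPredsV12 FinalTwoLegVolLimit klWindowC`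
imply crux K3 `KLRegimeTwoPointLimit` BY NAME. -/
theorem KLRegimeInductionV12P4 :
    EngineP4 klPredsV12 klWindowC → BetaSplitP klPredsV12 klWindowC → CountertermP2 klPredsV12 klWindowC →
      VolumeLimitP2 klPredsV12 FinalTwoLegVolLimit klWindowC → TwoPointAssemblyP3 klPredsV12 FinalTwoLegVolLimit klWindowC →
        Summit.HubbardSuperconductivity.HubbardSuperconductivity.Theses.KLProgramme.KLRegimeTwoPointLimit :=
  KLRegimeInductionP4 klPredsV12 FinalTwoLegVolLimit

end Summit.HubbardSuperconductivity.HubbardSuperconductivity.Theorems.KLRegimeSplit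

end
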